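import Mathlib
import Summits.FinalStateConjecture.FinalStateConjecture.Theorems.LaminatedThresholdCombMonotoneZero
import Summits.FinalStateConjecture.FinalStateConjecture.Theorems.LaminatedThresholdCombConeDynamics

/-!
# Comb lemma, layer 2: the preimage sheets of a seed graph

Under the tube hypotheses (H1)–(H3) of `CombConeDynamics` and for a Lipschitz seed graph
`t = g x` at heights in `[a, b]` above the tube (`ρ < a`, `b < (μ - δ) a`, `Lip g · κ < 1`), the
set of points `(x, t)` of the tube whose `n`-th iterate lies ON the seed graph is, for every
`n ≥ N`, the graph of a continuous function `h_n` over the ball `‖x‖ < ρ` (backward graph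
transform done with the intermediate value theorem: `t ↦ (Tⁿ(x,t)).2 - g((Tⁿ(x,t)).1)` is
continuous and strictly increasing). The sheets decrease strictly in `n`, converge uniformly at
rate `μ⁻ⁿ`, and a point lies below all of them iff its orbit never climbs strictly above the noise
level `‖x‖ < t`.
-/

set_option linter.dupNamespace false

namespace Summit.FinalStateConjecture.FinalStateConjecture.Theorems.LaminatedThreshold.Comb

open Set Function Filter Topology

variable {E : Type*} [NormedAddCommGroup E]

/-- The sheet function `t ↦ (Tⁿ(x,t)).2 - g((Tⁿ(x,t)).1)` is strictly increasing on every
vertical line of the tube. [folklore] -/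
theorem sheetFun_strictMono {T : E × ℝ → E × ℝ} {g : E → ℝ} {ρ lam μ κ kg : ℝ}
    (hlam0 : 0 ≤ lam) (hlam1 : lam ≤ 1) (hκ : 0 ≤ κ) (hμ : 0 < μ)
    (hx : ∀ p : E × ℝ, ‖p.1‖ ≤ ρ → ‖(T p).1‖ ≤ lam * ‖p.1‖)
    (hcone : ∀ p q : E × ℝ, ‖p.1‖ ≤ ρ → ‖q.1‖ ≤ ρ → p.2 ≤ q.2 → ‖q.1 - p.1‖ ≤ κ * (q.2 - p.2) →
      μ * (q.2 - p.2) ≤ (T q).2 - (T p).2 ∧ ‖(T q).1 - (T p).1‖ ≤ κ * ((T q).2 - (T p).2))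
    (hglip : ∀ x x' : E, ‖x‖ ≤ ρ → ‖x'‖ ≤ ρ → |g x - g x'| ≤ kg * ‖x - x'‖) (hkg0 : 0 ≤ kg)
    (hkg : kg * κ < 1) {x : E} (hxρ : ‖x‖ ≤ ρ) (n : ℕ) :
    StrictMono fun t : ℝ ↦ (T^[n] (x, t)).2 - g (T^[n] (x, t)).1 := by
  intro t t' htt'
  have h2 := iterate_two_point (p := (x, t)) (q := (x, t')) hlam0 hlam1 hκ hμ.le hx hcone hxρ rfl
    htt'.le n
  have hΔpos : 0 < (T^[n] (x, t')).2 - (T^[n] (x, t)).2 :=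
    lt_of_lt_of_le (mul_pos (pow_pos hμ n) (sub_pos.2 htt')) h2.1
  have hpn : ‖(T^[n] (x, t)).1‖ ≤ ρ := (iterate_fst_le hlam0 hlam1 hx (p := (x, t)) hxρ n).trans hxρ
  have hqn : ‖(T^[n] (x, t')).1‖ ≤ ρ :=
    (iterate_fst_le hlam0 hlam1 hx (p := (x, t')) hxρ n).trans hxρ
  have hg := hglip _ _ hqn hpn
  have hg' : |g (T^[n] (x, t')).1 - g (T^[n] (x, t)).1| ≤
      kg * κ * ((T^[n] (x, t')).2 - (T^[n] (x, t)).2) :=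
    hg.trans (by rw [mul_assoc]; exact mul_le_mul_of_nonneg_left h2.2 hkg0)
  have hlt : kg * κ * ((T^[n] (x, t')).2 - (T^[n] (x, t)).2) <
      (T^[n] (x, t')).2 - (T^[n] (x, t)).2 := by
    calc kg * κ * ((T^[n] (x, t')).2 - (T^[n] (x, t)).2)
        < 1 * ((T^[n] (x, t')).2 - (T^[n] (x, t)).2) := by gcongr
      _ = _ := one_mul _
  have := (abs_le.1 (hg'.trans hlt.le)).2
  show (T^[n] (x, t)).2 - g (T^[n] (x, t)).1 < (T^[n] (x, t')).2 - g (T^[n] (x, t')).1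
  linarith [(abs_le.1 hg').1, (abs_le.1 hg').2]

/-- The sheet function is jointly continuous on the tube. [folklore] -/
theorem sheetFun_continuousOn {T : E × ℝ → E × ℝ} {g : E → ℝ} {ρ lam kg : ℝ} (hT : Continuous T)
    (hlam0 : 0 ≤ lam) (hlam1 : lam ≤ 1)
    (hx : ∀ p : E × ℝ, ‖p.1‖ ≤ ρ → ‖(T p).1‖ ≤ lam * ‖p.1‖)
    (hglip : ∀ x x' : E, ‖x‖ ≤ ρ → ‖x'‖ ≤ ρ → |g x - g x'| ≤ kg * ‖x - x'‖) (n : ℕ) (A : Set ℝ) :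
    ContinuousOn (fun p : E × ℝ ↦ (T^[n] (p.1, p.2)).2 - g (T^[n] (p.1, p.2)).1)
      (Metric.closedBall (0 : E) ρ ×ˢ A) := by
  have hgcont : ContinuousOn g (Metric.closedBall (0 : E) ρ) := by
    have hlipw : LipschitzOnWith (Real.toNNReal kg) g (Metric.closedBall (0 : E) ρ) := by
      refine LipschitzOnWith.of_dist_le_mul fun x hx x' hx' ↦ ?_
      rw [mem_closedBall_zero_iff] at hx hx'
      rw [Real.dist_eq, dist_eq_norm]
      refine (hglip x x' hx hx').trans ?_
      gcongr
      exact Real.le_coe_toNNReal kg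
    exact hlipw.continuousOn
  have hiter : Continuous fun p : E × ℝ ↦ T^[n] (p.1, p.2) := by
    simp only [Prod.mk.eta]; exact hT.iterate n
  refine (continuous_snd.comp hiter).continuousOn.sub (hgcont.comp
    (continuous_fst.comp hiter).continuousOn fun p hp ↦ ?_)
  rw [mem_closedBall_zero_iff]
  have hp1 : ‖p.1‖ ≤ ρ := mem_closedBall_zero_iff.1 hp.1
  simpa using (iterate_fst_le hlam0 hlam1 hx (p := (p.1, p.2)) hp1 n).trans hp1

/-- **One preimage sheet.** For `n` with `b < (μ - δ)ⁿ ρ`, the points of the open tube whose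
`n`-th iterate lies on the seed graph form the graph of a continuous function over the ball
`‖x‖ < ρ`, with values in `(-ρ, ρ)`. [folklore] -/
theorem exists_sheet {T : E × ℝ → E × ℝ} {g : E → ℝ} {ρ lam μ κ δ a b kg : ℝ}
    (hT : Continuous T) (hlam0 : 0 ≤ lam) (hlam1 : lam ≤ 1) (hκ : 0 ≤ κ) (hδ : 0 ≤ δ)
    (hμδ : 1 < μ - δ)
    (hx : ∀ p : E × ℝ, ‖p.1‖ ≤ ρ → ‖(T p).1‖ ≤ lam * ‖p.1‖)
    (hcone : ∀ p q : E × ℝ, ‖p.1‖ ≤ ρ → ‖q.1‖ ≤ ρ → p.2 ≤ q.2 → ‖q.1 - p.1‖ ≤ κ * (q.2 - p.2) →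
      μ * (q.2 - p.2) ≤ (T q).2 - (T p).2 ∧ ‖(T q).1 - (T p).1‖ ≤ κ * ((T q).2 - (T p).2))
    (haxis : ∀ x : E, ‖x‖ ≤ ρ → |(T (x, 0)).2| ≤ δ * ‖x‖)
    (hga : ∀ x : E, ‖x‖ ≤ ρ → a ≤ g x) (hgb : ∀ x : E, ‖x‖ ≤ ρ → g x ≤ b) (ha : 0 < a)
    (hglip : ∀ x x' : E, ‖x‖ ≤ ρ → ‖x'‖ ≤ ρ → |g x - g x'| ≤ kg * ‖x - x'‖) (hkg0 : 0 ≤ kg)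
    (hkg : kg * κ < 1) {n : ℕ} (hn : b < (μ - δ) ^ n * ρ) :
    ∃ h : E → ℝ, ContinuousOn h (Metric.ball 0 ρ) ∧
      (∀ x ∈ Metric.ball (0 : E) ρ, h x ∈ Ioo (-ρ) ρ ∧
        (T^[n] (x, h x)).2 - g (T^[n] (x, h x)).1 = 0) ∧
      ∀ x ∈ Metric.ball (0 : E) ρ, ∀ t ∈ Icc (-ρ) ρ,
        (T^[n] (x, t)).2 - g (T^[n] (x, t)).1 = 0 → t = h x := by
  have hlamμ : lam < μ - δ := by linarith
  have hμ : 0 < μ := by linarith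
  have hρ : 0 ≤ ρ ∨ ρ < 0 := le_or_gt 0 ρ
  rcases hρ with hρ | hρ
  swap
  · -- empty ball: nothing to do
    refine ⟨fun _ ↦ 0, continuousOn_const, fun x hxS ↦ ?_, fun x hxS ↦ ?_⟩ <;>
    · rw [mem_ball_zero_iff] at hxS; linarith [norm_nonneg x]
  refine exists_continuousOn_zero (fun x t ↦ (T^[n] (x, t)).2 - g (T^[n] (x, t)).1)
    (Metric.ball 0 ρ) (by linarith : -ρ ≤ ρ) ?_ ?_ ?_ ?_
  · exact (sheetFun_continuousOn hT hlam0 hlam1 hx hglip n (Icc (-ρ) ρ)).mono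
      (prod_mono Metric.ball_subset_closedBall le_rfl)
  · intro x hxS
    exact (sheetFun_strictMono hlam0 hlam1 hκ hμ hx hcone hglip hkg0 hkg
      (mem_ball_zero_iff.1 hxS).le n).strictMonoOn _
  · intro x hxS
    have hxρ := mem_ball_zero_iff.1 hxS
    have hb := iterate_below hlam0 hlam1 hκ hδ hlamμ hx hcone haxis (p := (x, -ρ)) hxρ.le
      (by simp only; linarith) n
    have hneg : (T^[n] (x, -ρ)).2 < 0 :=
      hb.2.trans_le (neg_nonpos.2 (norm_nonneg _))
    have hgn : a ≤ g (T^[n] (x, -ρ)).1 :=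
      hga _ ((iterate_fst_le hlam0 hlam1 hx (p := (x, -ρ)) hxρ.le n).trans hxρ.le)
    show (T^[n] (x, -ρ)).2 - g (T^[n] (x, -ρ)).1 < 0
    linarith
  · intro x hxS
    have hxρ := mem_ball_zero_iff.1 hxS
    have hab := iterate_above hlam0 hlam1 hκ hδ hlamμ hx hcone haxis (p := (x, ρ)) hxρ.le
      (by simpa using hxρ) n
    have hgn : g (T^[n] (x, ρ)).1 ≤ b :=
      hgb _ ((iterate_fst_le hlam0 hlam1 hx (p := (x, ρ)) hxρ.le n).trans hxρ.le)
    show 0 < (T^[n] (x, ρ)).2 - g (T^[n] (x, ρ)).1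
    simp only at hab
    linarith [hab.1]


/-- **The upper sheet family.** Continuous sheets `H k` (`k ≥ 0`, the `(N + k)`-th preimages of
the seed graph) over the ball `‖x‖ < ρ`: strictly decreasing in `k`, uniformly convergent, their
points hit the seed graph at time `N + k` with heights `≤ b` before and never strictly below the
noise level; a point of the tube lies strictly below every sheet iff its orbit is never strictly
above the noise level. [folklore] -/
theorem exists_upper_sheets : ∀ {E : Type*} [NormedAddCommGroup E] {T : E × ℝ → E × ℝ} {g : E → ℝ} {ρ lam μ κ δ a b kg : ℝ}, Continuous T → 0 < ρ → 0 ≤ lam → lam ≤ 1 → 0 ≤ κ → 0 ≤ δ → 1 < μ - δ → (∀ p : E × ℝ, ‖p.1‖ ≤ ρ → ‖(T p).1‖ ≤ lam * ‖p.1‖) → (∀ p q : E × ℝ, ‖p.1‖ ≤ ρ → ‖q.1‖ ≤ ρ → p.2 ≤ q.2 → ‖q.1 - p.1‖ ≤ κ * (q.2 - p.2) → μ * (q.2 - p.2) ≤ (T q).2 - (T p).2 ∧ ‖(T q).1 - (T p).1‖ ≤ κ * ((T q).2 - (T p).2)) → (∀ x : E, ‖x‖ ≤ ρ → |(T (x,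 0)).2| ≤ δ * ‖x‖) → (∀ x : E, ‖x‖ ≤ ρ → a ≤ g x) → (∀ x : E, ‖x‖ ≤ ρ → g x ≤ b) → ρ < a → b < (μ - δ) * a → (∀ x x' : E, ‖x‖ ≤ ρ → ‖x'‖ ≤ ρ → |g x - g x'| ≤ kg * ‖x - x'‖) → 0 ≤ kg → kg * κ < 1 → ∃ (N : ℕ) (H : ℕ → E → ℝ) (Hinf : E → ℝ), (∀ k, ContinuousOn (H k) (Metric.ball 0 ρ)) ∧ (∀ k, ∀ x ∈ Metric.ball (0 : E) ρ, H (k + 1) x < H k x) ∧ TendstoUniformlyOn H Hinf Filter.atTop (Metric.ball 0 ρ) ∧ (∀ k, ∀ x ∈ Metric.ball (0 : E) ρ, H k x ∈ Set.Ioo (-ρ) ρ) ∧ (∀ k, ∀ x ∈ Metric.ball (0 : E) ρ, (T^[N + k] (x, H k x)).2 = g (T^[N + k] (x, H k x)).1) ∧ (∀ k, ∀ x ∈ Metric.ball (0 : E) ρ, ∀ j ≤ N + k, (T^[j] (x, H k x)).2 ≤ b) ∧ (∀ k, ∀ x ∈ Metric.ball (0 : E) ρ, ∀ j, -‖(T^[j]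 (x, H k x)).1‖ ≤ (T^[j] (x, H k x)).2) ∧ (∀ x ∈ Metric.ball (0 : E) ρ, ∀ t : ℝ, (∀ n, (T^[n] (x, t)).2 ≤ ‖(T^[n] (x, t)).1‖) → ∀ k, t < H k x) ∧ (∀ x ∈ Metric.ball (0 : E) ρ, ∀ t : ℝ, (∀ k, t < H k x) → ∀ n, (T^[n] (x, t)).2 ≤ ‖(T^[n] (x, t)).1‖) := by
  intro E _ T g ρ lam μ κ δ a b kg hT hρ hlam0 hlam1 hκ hδ hμδ hx hcone haxis hga hgb hρa hab hglip hkg0 hkg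
  have ha : 0 < a := hρ.trans hρa
  have hlamμ : lam < μ - δ := by linarith
  have hμ : 0 < μ := by linarith
  have hμ1 : 1 < μ := by linarith
  have hμδ0 : 0 ≤ μ - δ := by linarith
  have hab' : a ≤ b := (hga 0 (by simpa using hρ.le)).trans (hgb 0 (by simpa using hρ.le))
  -- the delay `N`
  obtain ⟨N, hN⟩ : ∃ N : ℕ, b < (μ - δ) ^ N * ρ := by
    obtain ⟨N, hN⟩ := pow_unbounded_of_one_lt (b / ρ) hμδ
    exact ⟨N, (div_lt_iff₀ hρ).1 hN⟩
  have hNk : ∀ k, b < (μ - δ) ^ (N + k) * ρ := fun k ↦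
    hN.trans_le (mul_le_mul_of_nonneg_right (pow_le_pow_right₀ hμδ.le (Nat.le_add_right N k))
      hρ.le)
  -- generic orbit facts in the tube
  have hfst : ∀ x ∈ Metric.ball (0 : E) ρ, ∀ t : ℝ, ∀ j, ‖(T^[j] (x, t)).1‖ ≤ ‖x‖ :=
    fun x hxS t j ↦ iterate_fst_le hlam0 hlam1 hx (p := (x, t)) (mem_ball_zero_iff.1 hxS).le j
  -- an orbit that is ON the seed graph at time `n` is never strictly below the noise level
  have hGL1 : ∀ x ∈ Metric.ball (0 : E) ρ, ∀ t : ℝ, ∀ n,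
      (T^[n] (x, t)).2 = g (T^[n] (x, t)).1 → ∀ j, -‖(T^[j] (x, t)).1‖ ≤ (T^[j] (x, t)).2 := by
    intro x hxS t n hhit j
    have hxρ := mem_ball_zero_iff.1 hxS
    by_contra hlt
    push Not at hlt
    rcases le_or_gt j n with hjn | hnj
    · -- descend from time `j` to time `n`
      obtain ⟨m, rfl⟩ := Nat.exists_eq_add_of_le hjn
      have hb := iterate_below hlam0 hlam1 hκ hδ hlamμ hx hcone haxis (p := T^[j] (x, t))
        ((hfst x hxS t j).trans hxρ.le) hlt m
      rw [← iterate_add_apply, add_comm] at hb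
      have hgn : a ≤ g (T^[j + m] (x, t)).1 := hga _ ((hfst x hxS t _).trans hxρ.le)
      linarith [hb.2, norm_nonneg (T^[j + m] (x, t)).1]
    · -- at time `n` the point is strictly above the noise level, then it climbs
      obtain ⟨m, rfl⟩ := Nat.exists_eq_add_of_le hnj.le
      have habove : ‖(T^[n] (x, t)).1‖ < (T^[n] (x, t)).2 := by
        rw [hhit]
        exact lt_of_le_of_lt ((hfst x hxS t n).trans hxρ.le)
          (hρa.trans_le (hga _ ((hfst x hxS t n).trans hxρ.le)))
      have hab2 := iterate_above hlam0 hlam1 hκ hδ hlamμ hx hcone haxis (p := T^[n] (x, t))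
        ((hfst x hxS t n).trans hxρ.le) habove m
      rw [← iterate_add_apply, add_comm] at hab2
      linarith [hab2.2, norm_nonneg (T^[n + m] (x, t)).1]
  -- an orbit that is ON the seed graph at time `n` has heights `≤ b` up to time `n`
  have hGL2 : ∀ x ∈ Metric.ball (0 : E) ρ, ∀ t : ℝ, ∀ n,
      (T^[n] (x, t)).2 = g (T^[n] (x, t)).1 → ∀ j ≤ n, (T^[j] (x, t)).2 ≤ b := by
    intro x hxS t n hhit j hjn
    have hxρ := mem_ball_zero_iff.1 hxS
    rcases le_or_gt (T^[j] (x, t)).2 ‖(T^[j] (x, t)).1‖ with hle | hgt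
    · exact hle.trans (((hfst x hxS t j).trans hxρ.le).trans (hρa.le.trans hab'))
    · obtain ⟨m, rfl⟩ := Nat.exists_eq_add_of_le hjn
      have hab2 := iterate_above hlam0 hlam1 hκ hδ hlamμ hx hcone haxis (p := T^[j] (x, t))
        ((hfst x hxS t j).trans hxρ.le) hgt m
      rw [← iterate_add_apply, add_comm] at hab2
      have hpos : 0 < (T^[j] (x, t)).2 := (norm_nonneg _).trans_lt hgt
      have h1 : (T^[j] (x, t)).2 ≤ (μ - δ) ^ m * (T^[j] (x, t)).2 :=
        le_mul_of_one_le_left hpos.le (one_le_pow₀ hμδ.le)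
      have hgn : g (T^[j + m] (x, t)).1 ≤ b := hgb _ ((hfst x hxS t _).trans hxρ.le)
      linarith [hab2.1]
  -- the sheets
  have hex : ∀ k, ∃ h : E → ℝ, ContinuousOn h (Metric.ball 0 ρ) ∧
      (∀ x ∈ Metric.ball (0 : E) ρ, h x ∈ Ioo (-ρ) ρ ∧
        (T^[N + k] (x, h x)).2 - g (T^[N + k] (x, h x)).1 = 0) ∧
      ∀ x ∈ Metric.ball (0 : E) ρ, ∀ t ∈ Icc (-ρ) ρ,
        (T^[N + k] (x, t)).2 - g (T^[N + k] (x, t)).1 = 0 → t = h x := fun k ↦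
    exists_sheet hT hlam0 hlam1 hκ hδ hμδ hx hcone haxis hga hgb ha hglip hkg0 hkg (hNk k)
  choose H hHc hHz hHu using hex
  have hhit : ∀ k, ∀ x ∈ Metric.ball (0 : E) ρ,
      (T^[N + k] (x, H k x)).2 = g (T^[N + k] (x, H k x)).1 :=
    fun k x hxS ↦ sub_eq_zero.1 (hHz k x hxS).2
  -- strict monotonicity of the sheet functions, by name
  have hsm : ∀ x ∈ Metric.ball (0 : E) ρ, ∀ n,
      StrictMono fun t : ℝ ↦ (T^[n] (x, t)).2 - g (T^[n] (x, t)).1 := fun x hxS n ↦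
    sheetFun_strictMono hlam0 hlam1 hκ hμ hx hcone hglip hkg0 hkg (mem_ball_zero_iff.1 hxS).le n
  -- two-point comparison, by name
  have h2pt : ∀ x ∈ Metric.ball (0 : E) ρ, ∀ t t' : ℝ, t ≤ t' → ∀ n,
      μ ^ n * (t' - t) ≤ (T^[n] (x, t')).2 - (T^[n] (x, t)).2 := fun x hxS t t' htt' n ↦
    (iterate_two_point (p := (x, t)) (q := (x, t')) hlam0 hlam1 hκ hμ.le hx hcone
      (mem_ball_zero_iff.1 hxS).le rfl htt' n).1
  -- never strictly above the noise level ⇒ strictly below every sheet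
  have hbelow : ∀ x ∈ Metric.ball (0 : E) ρ, ∀ t : ℝ,
      (∀ n, (T^[n] (x, t)).2 ≤ ‖(T^[n] (x, t)).1‖) → ∀ k, t < H k x := by
    intro x hxS t hnoise k
    have hxρ := mem_ball_zero_iff.1 hxS
    by_contra hle
    push Not at hle
    have h := h2pt x hxS (H k x) t hle (N + k)
    have hnn : 0 ≤ μ ^ (N + k) * (t - H k x) := mul_nonneg (pow_nonneg hμ.le _) (sub_nonneg.2 hle)
    have hgn : a ≤ g (T^[N + k] (x, H k x)).1 := hga _ ((hfst x hxS _ _).trans hxρ.le)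
    have h1 := hnoise (N + k)
    have h2 := (hfst x hxS t (N + k)).trans hxρ.le
    linarith [hhit k x hxS]
  -- strictly below every sheet ⇒ never strictly above the noise level
  have habove : ∀ x ∈ Metric.ball (0 : E) ρ, ∀ t : ℝ,
      (∀ k, t < H k x) → ∀ n, (T^[n] (x, t)).2 ≤ ‖(T^[n] (x, t)).1‖ := by
    intro x hxS t hlt j
    have hxρ := mem_ball_zero_iff.1 hxS
    by_contra hgt
    push Not at hgt
    have hpos : 0 < (T^[j] (x, t)).2 := (norm_nonneg _).trans_lt hgt
    obtain ⟨m₁, hm₁⟩ := pow_unbounded_of_one_lt (b / (T^[j] (x, t)).2) hμδ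
    set m := m₁ + N with hm
    have hmb : b < (μ - δ) ^ m * (T^[j] (x, t)).2 := by
      have := (div_lt_iff₀ hpos).1 hm₁
      refine this.trans_le (mul_le_mul_of_nonneg_right
        (pow_le_pow_right₀ hμδ.le (Nat.le_add_right m₁ N)) hpos.le)
    have hab2 := iterate_above hlam0 hlam1 hκ hδ hlamμ hx hcone haxis (p := T^[j] (x, t))
      ((hfst x hxS t j).trans hxρ.le) hgt m
    rw [← iterate_add_apply] at hab2
    -- write `m + j = N + k`
    obtain ⟨k, hk⟩ : ∃ k, m + j = N + k := ⟨m₁ + j, by rw [hm]; ring⟩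
    rw [hk] at hab2
    have h := h2pt x hxS t (H k x) (hlt k).le (N + k)
    have hpos2 : 0 < μ ^ (N + k) * (H k x - t) := mul_pos (pow_pos hμ _) (sub_pos.2 (hlt k))
    have hgn : g (T^[N + k] (x, H k x)).1 ≤ b := hgb _ ((hfst x hxS _ _).trans hxρ.le)
    linarith [hab2.1, hhit k x hxS]
  -- the sheets decrease strictly
  have horder : ∀ k, ∀ x ∈ Metric.ball (0 : E) ρ, H (k + 1) x < H k x := by
    intro k x hxS
    have hxρ := mem_ball_zero_iff.1 hxS
    have hr2 : (T^[N + k] (x, H k x)).2 = g (T^[N + k] (x, H k x)).1 := hhit k x hxS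
    have hrabove : ‖(T^[N + k] (x, H k x)).1‖ < (T^[N + k] (x, H k x)).2 := by
      rw [hr2]
      exact lt_of_le_of_lt ((hfst x hxS _ _).trans hxρ.le)
        (hρa.trans_le (hga _ ((hfst x hxS _ _).trans hxρ.le)))
    have hstep := step_above hlam0 hκ hδ hlamμ hx hcone haxis ((hfst x hxS _ _).trans hxρ.le)
      hrabove
    have hval : 0 < (T^[N + (k + 1)] (x, H k x)).2 - g (T^[N + (k + 1)] (x, H k x)).1 := by
      have hTsucc : T^[N + (k + 1)] (x, H k x) = T (T^[N + k] (x, H k x)) := by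
        rw [← add_assoc, iterate_succ_apply']
      rw [hTsucc]
      have hgn : g (T (T^[N + k] (x, H k x))).1 ≤ b := by
        refine hgb _ ?_
        rw [← hTsucc]; exact (hfst x hxS _ _).trans hxρ.le
      have hga' : a ≤ g (T^[N + k] (x, H k x)).1 := hga _ ((hfst x hxS _ _).trans hxρ.le)
      nlinarith [hstep.1, hμδ0]
    have hzero : (T^[N + (k + 1)] (x, H (k + 1) x)).2 - g (T^[N + (k + 1)] (x, H (k + 1) x)).1
        = 0 := (hHz (k + 1) x hxS).2
    exact (hsm x hxS (N + (k + 1))).lt_iff_lt.1 (hzero ▸ hval)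
  have hanti : ∀ x ∈ Metric.ball (0 : E) ρ, ∀ {k k' : ℕ}, k ≤ k' → H k' x ≤ H k x :=
    fun x hxS k k' hkk' ↦
      (strictAnti_nat_of_succ_lt (f := fun k ↦ H k x) fun k ↦ horder k x hxS).antitone hkk'
  -- the Cauchy estimate
  set C : ℝ := b + ρ with hC
  have hC0 : 0 ≤ C := by linarith
  have hcauchy : ∀ x ∈ Metric.ball (0 : E) ρ, ∀ k k', k ≤ k' →
      H k x - H k' x ≤ C / μ ^ (N + k) := by
    intro x hxS k k' hkk'
    have hxρ := mem_ball_zero_iff.1 hxS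
    have h := h2pt x hxS (H k' x) (H k x) (hanti x hxS hkk') (N + k)
    have htop : (T^[N + k] (x, H k x)).2 ≤ b := by
      rw [hhit k x hxS]; exact hgb _ ((hfst x hxS _ _).trans hxρ.le)
    have hbot : -ρ ≤ (T^[N + k] (x, H k' x)).2 := by
      have h1 := hGL1 x hxS (H k' x) (N + k') (hhit k' x hxS) (N + k)
      have h2 := (hfst x hxS (H k' x) (N + k)).trans hxρ.le
      linarith
    rw [le_div_iff₀ (pow_pos hμ _)]
    nlinarith [pow_pos hμ (N + k)]
  -- the limit sheet
  set Hinf : E → ℝ := fun x ↦ ⨅ k, H k x with hHinf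
  have hbdd : ∀ x ∈ Metric.ball (0 : E) ρ, BddBelow (range fun k ↦ H k x) :=
    fun x hxS ↦ ⟨-ρ, by rintro _ ⟨k, rfl⟩; exact (hHz k x hxS).1.1.le⟩
  have hinf_le : ∀ x ∈ Metric.ball (0 : E) ρ, ∀ k, Hinf x ≤ H k x :=
    fun x hxS k ↦ ciInf_le (hbdd x hxS) k
  have hle_inf : ∀ x ∈ Metric.ball (0 : E) ρ, ∀ k, H k x - C / μ ^ (N + k) ≤ Hinf x := by
    intro x hxS k
    refine le_ciInf fun k' ↦ ?_
    rcases le_or_gt k k' with hkk' | hkk'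
    · linarith [hcauchy x hxS k k' hkk']
    · have h1 := hanti x hxS hkk'.le
      have h2 : 0 ≤ C / μ ^ (N + k) := div_nonneg hC0 (pow_nonneg hμ.le _)
      linarith
  have hunif : TendstoUniformlyOn H Hinf atTop (Metric.ball 0 ρ) := by
    rw [Metric.tendstoUniformlyOn_iff]
    intro ε hε
    have htend : Tendsto (fun k : ℕ ↦ C / μ ^ (N + k)) atTop (𝓝 0) := by
      have h1 : Tendsto (fun k : ℕ ↦ μ ^ (N + k)) atTop atTop := by
        have := (tendsto_pow_atTop_atTop_of_one_lt hμ1).comp (tendsto_add_atTop_nat N)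
        refine this.congr fun k ↦ ?_
        simp [add_comm]
      exact tendsto_const_nhds.div_atTop h1
    filter_upwards [(tendsto_order.1 htend).2 ε hε] with k hk x hxS
    rw [Real.dist_eq, abs_sub_comm, abs_of_nonneg (sub_nonneg.2 (hinf_le x hxS k))]
    linarith [hle_inf x hxS k]
  exact ⟨N, H, Hinf, hHc, horder, hunif, fun k x hxS ↦ (hHz k x hxS).1, hhit,
    fun k x hxS j hj ↦ hGL2 x hxS (H k x) (N + k) (hhit k x hxS) j hj,
    fun k x hxS j ↦ hGL1 x hxS (H k x) (N + k) (hhit k x hxS) j, hbelow, habove⟩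

end Summit.FinalStateConjecture.FinalStateConjecture.Theorems.LaminatedThreshold.Comb
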